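import Literature.Claims.NS.Faliush2026
import Literature.Analysis.FluidPDE.NSGalerkinFourier
import Literature.Analysis.FluidPDE.TorusNSSmoothLocalExistence
import Literature.Barriers.NavierStokesRegularity.ScalingAudit
import HarnessLib

/-!
# C141 `Faliush2026` — companion refutation of Theorem 1 (p. 3 l. 3–13, `Step_Thm1`) by the amplitude
# ray through a two-shell triad (records-grade companion to `not_Step_L1a`; typist-2 g5 kit)

**Printed statement (Theorem 1, «Spectral Dissipation Barrier», p. 3 l. 3–13).** «There exists `σ₀ > 0` such
that `N_{σ₀}(u) := |⟨e^{σ₀Δ}(u·∇u), e^{σ₀Δ}u⟩| ≤ ½ C_ν D̃_{σ₀}(u)` for all smooth divergence-free solutions» —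
typed (spectrally, on `𝕋³`) as `Literature.Claims.NS.Faliush2026.Step_Thm1` (`σ₀`, `C_ν` after `ν`, before
the solution).

**Countermodel.** `N_σ(λv) = λ³ N_σ(v)` and `D̃_σ(λv) = λ² D̃_σ(v)`, so on the amplitude ray through ONE smooth
divergence-free field `v` with `N_{σ₀}(v) > 0` no constant works (tree `ScalingAudit`, degrees `3 ≠ 2`); every
`λ v` is the time-`0` slice of a classical solution (`Torus.exists_classicalNS_smooth`). The witness must serve
EVERY `σ₀ > 0`: `N_0(v) = 0` for divergence-free `v`, single-shell fields have `N_σ ≡ 0`, two-dimensional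
two-shell fields too (energy + enstrophy conservation); the 2½-D two-shell triad `k₁ = (2,0,0)` (`|k|² = 4`),
`k₂ = (−1,1,0)`, `k₃ = (−1,−1,0)` (`|k|² = 2`) with amplitudes `½e_z`, `½(e_x+e_y)`, `∓(i/2)e_z`, i.e.
`v = (cos 2π(y−x), cos 2π(y−x), cos 4πx − sin 2π(x+y))`, has
`⟨e^{σΔ}((v·∇)v), e^{σΔ}v⟩ = π (e^{−16π²σ} − e^{−32π²σ}) > 0` for every `σ > 0`
(`pairW_convect_witness`), from the Galerkin convolution formula `mFourierCoeff_convect_realTrigPoly`.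

* `not_Step_Thm1 : ¬ Literature.Claims.NS.Faliush2026.Step_Thm1`.

WHAT THIS IS NOT: not a claim about NS regularity or blow-up; not a claim about any author beyond the
typed locator.
-/

set_option linter.dupNamespace false

noncomputable section

open Set UnitAddTorus Function MeasureTheory
open Literature.Analysis.FunctionSpaces Literature.Analysis.FunctionSpaces.Torus
open Literature.Analysis.FluidPDE Literature.Analysis.FluidPDE.Torus
open Literature.Claims.NS.Faliush2026

namespace Summit.NavierStokesRegularity.NavierStokesRegularity.Theorems.Faliush2026Thm1

/-! ## Amplitude homogeneity of the typed functionals -/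
/-- `(c • v)^(k) = c • v̂(k)`. [folklore] -/
theorem coeff_const_smul (a : ℝ) (v : T3 → E3) (k : Z3) : coeff (a • v) k = (a : ℂ) • coeff v k := by
  have h : (EuclideanSpace.complexify ∘ (a • v) : T3 → EuclideanSpace ℂ (Fin 3)) =
      fun x => (a : ℂ) • (EuclideanSpace.complexify ∘ v) x := by
    funext x
    rw [comp_apply, Pi.smul_apply, map_smul, RCLike.real_smul_eq_coe_smul (K := ℂ)]
    rfl
  unfold coeff
  rw [h]
  unfold mFourierCoeff
  simp_rw [smul_comm (mFourier (-k) _) (a : ℂ)]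
  exact integral_smul _ _
/-- `D̃_σ(a v) = a² D̃_σ(v)`. [folklore] -/
theorem Dw_const_smul (σ a : ℝ) (v : T3 → E3) : Dw σ (a • v) = a ^ 2 * Dw σ v := by
  unfold Dw
  rw [← tsum_mul_left]
  congr 1 with k
  rw [coeff_const_smul, norm_smul, mul_pow, Complex.norm_real, Real.norm_eq_abs, sq_abs]; ring
/-- `⟨a f, b g⟩_σ = a b ⟨f, g⟩_σ`. [folklore] -/
theorem pairW_const_smul (σ a b : ℝ) (f g : T3 → E3) :
    pairW σ (a • f) (b • g) = a * b * pairW σ f g := by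
  unfold pairW
  rw [← tsum_mul_left]
  congr 1 with k
  rw [coeff_const_smul, coeff_const_smul, inner_smul_left, inner_smul_right, Complex.conj_ofReal,
    RCLike.re_to_complex, RCLike.re_to_complex, Complex.re_ofReal_mul, Complex.re_ofReal_mul]
  ring
/-- `((a u)·∇)(b v) = (a b) (u·∇)v` for smooth `v`. [folklore] -/
theorem convect_const_smul {v : T3 → E3} (hv : Torus.IsSmooth v) (u : T3 → E3) (a b : ℝ) :
    Torus.convect (a • u) (b • v) = (a * b) • Torus.convect u v := by
  funext x
  show Torus.fderiv (b • v) x ((a • u) x) = (a * b) • Torus.fderiv v x (u x)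
  rw [Pi.smul_apply, Torus.fderiv_const_smul (hv.isContDiff (by simp)) b,
    FunLike.coe_smul, Pi.smul_apply, map_smul, smul_smul, mul_comm b a]
/-- `N_σ(a v) = |a|³ N_σ(v)` for smooth `v`. [folklore] -/
theorem Nw_const_smul {v : T3 → E3} (hv : Torus.IsSmooth v) (σ a : ℝ) :
    Nw σ (a • v) = |a| ^ 3 * Nw σ v := by
  unfold Nw
  rw [convect_const_smul hv, pairW_const_smul, abs_mul, show |a * a * a| = |a| ^ 3 by
    rw [abs_mul, abs_mul]; ring]
/-- Constant multiples of smooth divergence-free fields on `𝕋³` are divergence free. [folklore] -/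
theorem isDivFree_const_smul {v : T3 → E3} (hv : Torus.IsSmooth v) (hdiv : Torus.IsDivFree v) (a : ℝ) :
    Torus.IsDivFree (a • v) := by
  intro x
  unfold Torus.divergence
  have h : ∀ i, Torus.partialDeriv i (fun y => (a • v) y i) x =
      a * Torus.partialDeriv i (fun y => v y i) x := fun i => by
    have hvi : Torus.IsContDiff 1 (fun y => v y i) :=
      (EuclideanSpace.proj i : E3 →L[ℝ] ℝ).contDiff.comp (hv.isContDiff (n := 1) (by simp))
    have hfun : (fun y => (a • v) y i) = a • fun y => v y i := by
      funext y; simp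
    rw [hfun, Torus.partialDeriv_const_smul hvi]
    rfl
  simp_rw [h, ← Finset.mul_sum]
  have := hdiv x
  unfold Torus.divergence at this
  rw [this, mul_zero]
/-- **Amplitude ray**: one smooth divergence-free field with `N_{σ₀}(v₀) > 0` defeats every constant in
`N_{σ₀} ≤ ½ C D̃_{σ₀}` over smooth divergence-free fields (degrees `3 ≠ 2`).
[cite: Tao2007WhyNSHard, supercriticality paragraph] -/
theorem not_exists_const_of_pos {σ₀ : ℝ} {v₀ : T3 → E3} (hv₀ : Torus.IsSmooth v₀)
    (hdiv₀ : Torus.IsDivFree v₀) (hpos : 0 < Nw σ₀ v₀) :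
    ¬ ∃ C : ℝ, ∀ v : T3 → E3, Torus.IsSmooth v → Torus.IsDivFree v →
      Nw σ₀ v ≤ (1 / 2 : ℝ) * C * Dw σ₀ v := by
  rintro ⟨C, hC⟩
  have key := Literature.Barriers.NavierStokesRegularity.ScalingAudit.not_exists_forall_le_of_amplitude_exponent_ne
    (S := {v : T3 → E3 | Torus.IsSmooth v ∧ Torus.IsDivFree v}) (F := Nw σ₀) (G := Dw σ₀)
    (s := 3) (r := 2)
    (fun l _ u hu => ⟨hu.1.smul l, isDivFree_const_smul hu.1 hu.2 l⟩)
    (fun l hl u hu => by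
      rw [Nw_const_smul hu.1, abs_of_pos hl]
      norm_cast)
    (fun l hl u _ => by
      rw [Dw_const_smul]
      norm_cast)
    (by norm_num) (u₀ := v₀) ⟨hv₀, hdiv₀⟩ hpos
  exact key ⟨(1 / 2 : ℝ) * C, fun u hu => hC u hu.1 hu.2⟩

/-! ## The two-shell witness -/
/-- `k₁ = (2,0,0)`, `|k₁|² = 4`. -/
def k₁ : Z3 := ![2, 0, 0]
/-- `k₂ = (−1,1,0)`, `|k₂|² = 2`. -/
def k₂ : Z3 := ![-1, 1, 0]
/-- `k₃ = (−1,−1,0)`, `|k₃|² = 2`; `k₁ + k₂ + k₃ = 0`. -/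
def k₃ : Z3 := ![-1, -1, 0]
/-- The symmetric frequency set `{±k₁, ±k₂, ±k₃}`. -/
def S : Finset Z3 := {k₁, -k₁, k₂, -k₂, k₃, -k₃}
/-- `e_z ∈ ℂ³`. -/
def ez : EuclideanSpace ℂ (Fin 3) := EuclideanSpace.single 2 1
/-- `e_x + e_y ∈ ℂ³`. -/
def eh : EuclideanSpace ℂ (Fin 3) := EuclideanSpace.single 0 1 + EuclideanSpace.single 1 1
/-- The coefficient family: `½e_z` on `±k₁`, `½(e_x+e_y)` on `±k₂`, `−(i/2)e_z` on `k₃`, `(i/2)e_z` on `−k₃`. -/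
def c : Z3 → EuclideanSpace ℂ (Fin 3) := fun k =>
  if k = k₁ ∨ k = -k₁ then (1 / 2 : ℂ) • ez
  else if k = k₂ ∨ k = -k₂ then (1 / 2 : ℂ) • eh
  else if k = k₃ then (-(Complex.I / 2)) • ez
  else if k = -k₃ then (Complex.I / 2) • ez
  else 0
/-- The witness field `v = (cos 2π(y−x), cos 2π(y−x), cos 4πx − sin 2π(x+y))`. -/
def vW : T3 → E3 := realTrigPoly S c
/-- kit lemma (plumbing) [folklore] -/
theorem sum_S {M : Type*} [AddCommMonoid M] (f : Z3 → M) :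
    ∑ k ∈ S, f k = f k₁ + f (-k₁) + f k₂ + f (-k₂) + f k₃ + f (-k₃) := by
  simp only [S]
  rw [Finset.sum_insert (by decide), Finset.sum_insert (by decide), Finset.sum_insert (by decide),
    Finset.sum_insert (by decide), Finset.sum_insert (by decide), Finset.sum_singleton]
  simp only [add_assoc]
/-- kit lemma (plumbing) [folklore] -/
theorem S_symm : ∀ k ∈ S, -k ∈ S := by decide
/-- kit lemma (plumbing) [folklore] -/
theorem mem_S_iff (k : Z3) : k ∈ S ↔ k = k₁ ∨ k = -k₁ ∨ k = k₂ ∨ k = -k₂ ∨ k = k₃ ∨ k = -k₃ := by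
  simp only [S, Finset.mem_insert, Finset.mem_singleton]
/-- kit lemma (plumbing) [folklore] -/
theorem c_k₁ : c k₁ = (1 / 2 : ℂ) • ez := by unfold c; rw [if_pos (by decide)]
/-- kit lemma (plumbing) [folklore] -/
theorem c_nk₁ : c (-k₁) = (1 / 2 : ℂ) • ez := by unfold c; rw [if_pos (by decide)]
/-- kit lemma (plumbing) [folklore] -/
theorem c_k₂ : c k₂ = (1 / 2 : ℂ) • eh := by unfold c; rw [if_neg (by decide), if_pos (by decide)]
/-- kit lemma (plumbing) [folklore] -/
theorem c_nk₂ : c (-k₂) = (1 / 2 : ℂ) • eh := by unfold c; rw [if_neg (by decide), if_pos (by decide)]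
/-- kit lemma (plumbing) [folklore] -/
theorem c_k₃ : c k₃ = (-(Complex.I / 2)) • ez := by
  unfold c; rw [if_neg (by decide), if_neg (by decide), if_pos (by decide)]
/-- kit lemma (plumbing) [folklore] -/
theorem c_nk₃ : c (-k₃) = (Complex.I / 2) • ez := by
  unfold c; rw [if_neg (by decide), if_neg (by decide), if_neg (by decide), if_pos (by decide)]
/-- kit lemma (plumbing) [folklore] -/
theorem c_of_not_mem {k : Z3} (hk : k ∉ S) : c k = 0 := by
  rw [mem_S_iff] at hk
  push Not at hk
  unfold c
  rw [if_neg (not_or.2 ⟨hk.1, hk.2.1⟩), if_neg (not_or.2 ⟨hk.2.2.1, hk.2.2.2.1⟩), if_neg hk.2.2.2.2.1,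
    if_neg hk.2.2.2.2.2]
/-- kit lemma (plumbing) [folklore] -/
theorem conjVec_ez : EuclideanSpace.conjVec ez = ez := by
  ext i
  fin_cases i <;> simp [ez, EuclideanSpace.conjVec_apply]
/-- kit lemma (plumbing) [folklore] -/
theorem conjVec_eh : EuclideanSpace.conjVec eh = eh := by
  ext i
  fin_cases i <;> simp [eh, EuclideanSpace.conjVec_apply]
/-- kit lemma (plumbing) [folklore] -/
theorem conj_half : starRingEnd ℂ (1 / 2 : ℂ) = 1 / 2 := by
  simp [Complex.ext_iff]
/-- kit lemma (plumbing) [folklore] -/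
theorem conj_two : starRingEnd ℂ (2 : ℂ) = 2 := by
  rw [show (2 : ℂ) = ((2 : ℝ) : ℂ) by norm_num, Complex.conj_ofReal]
/-- kit lemma (plumbing) [folklore] -/
theorem conj_Ihalf : starRingEnd ℂ (Complex.I / 2) = -(Complex.I / 2) := by
  rw [map_div₀, Complex.conj_I, conj_two, neg_div]
/-- kit lemma (plumbing) [folklore] -/
theorem conj_negIhalf : starRingEnd ℂ (-(Complex.I / 2)) = Complex.I / 2 := by
  rw [map_neg, conj_Ihalf, neg_neg]
/-- kit lemma (plumbing) [folklore] -/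
theorem c_conjSymm : IsConjSymm c := by
  intro k
  by_cases hk : k ∈ S
  · rw [mem_S_iff] at hk
    rcases hk with rfl | rfl | rfl | rfl | rfl | rfl
    · rw [c_nk₁, c_k₁, EuclideanSpace.conjVec_smul, conj_half, conjVec_ez]
    · rw [neg_neg, c_k₁, c_nk₁, EuclideanSpace.conjVec_smul, conj_half, conjVec_ez]
    · rw [c_nk₂, c_k₂, EuclideanSpace.conjVec_smul, conj_half, conjVec_eh]
    · rw [neg_neg, c_k₂, c_nk₂, EuclideanSpace.conjVec_smul, conj_half, conjVec_eh]
    · rw [c_nk₃, c_k₃, EuclideanSpace.conjVec_smul, conj_negIhalf, conjVec_ez]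
    · rw [neg_neg, c_k₃, c_nk₃, EuclideanSpace.conjVec_smul, conj_Ihalf, conjVec_ez]
  · have hnk : -k ∉ S := fun h => hk (by simpa using S_symm (-k) h)
    rw [c_of_not_mem hk, c_of_not_mem hnk, EuclideanSpace.conjVec_zero]
/-- kit lemma (plumbing) [folklore] -/
theorem c_transversal : IsTransversal S c := by
  intro k hk
  rw [mem_S_iff] at hk
  rcases hk with rfl | rfl | rfl | rfl | rfl | rfl
  · rw [c_k₁]; simp [ez, k₁]
  · rw [c_nk₁]; simp [ez, k₁]
  · rw [c_k₂]; simp [eh, k₂, Fin.sum_univ_three]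
  · rw [c_nk₂]; simp [eh, k₂, Fin.sum_univ_three]
  · rw [c_k₃]; simp [ez, k₃]
  · rw [c_nk₃]; simp [ez, k₃]
/-- kit lemma (plumbing) [folklore] -/
theorem isSmooth_vW : Torus.IsSmooth vW := isSmooth_realTrigPoly S c
/-- kit lemma (plumbing) [folklore] -/
theorem isDivFree_vW : Torus.IsDivFree vW := isDivFree_realTrigPoly c_transversal
/-- Fourier coefficients of the witness. -/
theorem coeff_vW (k : Z3) : coeff vW k = if k ∈ S then c k else 0 :=
  mFourierCoeff_realTrigPoly S_symm c_conjSymm k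
/-- Fourier coefficients of `(v·∇)v` (Galerkin convolution formula). -/
theorem coeff_convect_vW (k : Z3) : coeff (Torus.convect vW vW) k = convectionCoeff S c c k :=
  mFourierCoeff_convect_realTrigPoly S_symm c_conjSymm c_conjSymm k

/-! ### The six convolution coefficients on the support -/
/-- kit lemma (plumbing) [folklore] -/
theorem CC_k₁ : convectionCoeff S c c k₁ = (-(Real.pi : ℂ)) • ez := by
  unfold convectionCoeff
  rw [sum_S]; simp only [sum_S]
  simp (config := { decide := true }) only [if_true, if_false, zero_add, add_zero]
  rw [c_nk₂, c_nk₃]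
  ext i
  fin_cases i <;> simp [eh, ez, k₂, k₃, Fin.sum_univ_three]
  linear_combination (Real.pi : ℂ) * Complex.I_mul_I
/-- kit lemma (plumbing) [folklore] -/
theorem CC_nk₁ : convectionCoeff S c c (-k₁) = (-(Real.pi : ℂ)) • ez := by
  unfold convectionCoeff
  rw [sum_S]; simp only [sum_S]
  simp (config := { decide := true }) only [if_true, if_false, zero_add, add_zero]
  rw [c_k₂, c_k₃]
  ext i
  fin_cases i <;> simp [eh, ez, k₂, k₃, Fin.sum_univ_three]
  linear_combination (-(Real.pi : ℂ)) * Complex.I_mul_I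
/-- kit lemma (plumbing) [folklore] -/
theorem CC_k₂ : convectionCoeff S c c k₂ = 0 := by
  unfold convectionCoeff
  rw [sum_S]; simp only [sum_S]
  simp (config := { decide := true }) only [if_true, if_false, zero_add, add_zero]
  rw [c_nk₁, c_nk₃]
  ext i
  fin_cases i <;> simp [ez, k₁, k₃]
/-- kit lemma (plumbing) [folklore] -/
theorem CC_nk₂ : convectionCoeff S c c (-k₂) = 0 := by
  unfold convectionCoeff
  rw [sum_S]; simp only [sum_S]
  simp (config := { decide := true }) only [if_true, if_false, zero_add, add_zero]
  rw [c_k₁, c_k₃]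
  ext i
  fin_cases i <;> simp [ez, k₁, k₃]
/-- kit lemma (plumbing) [folklore] -/
theorem CC_k₃ : convectionCoeff S c c k₃ = (-(Real.pi * Complex.I)) • ez := by
  unfold convectionCoeff
  rw [sum_S]; simp only [sum_S]
  simp (config := { decide := true }) only [if_true, if_false, zero_add, add_zero]
  rw [c_nk₁, c_nk₂]
  ext i
  fin_cases i <;> simp [eh, ez, k₁, k₂, Fin.sum_univ_three]
  ring
/-- kit lemma (plumbing) [folklore] -/
theorem CC_nk₃ : convectionCoeff S c c (-k₃) = (Real.pi * Complex.I) • ez := by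
  unfold convectionCoeff
  rw [sum_S]; simp only [sum_S]
  simp (config := { decide := true }) only [if_true, if_false, zero_add, add_zero]
  rw [c_k₁, c_k₂]
  ext i
  fin_cases i <;> simp [eh, ez, k₁, k₂, Fin.sum_univ_three]
  ring

/-! ### The six pairings `Re ⟪((v·∇)v)^(k), v̂(k)⟫` -/
/-- kit lemma (plumbing) [folklore] -/
theorem inner_ez_ez : inner ℂ ez ez = 1 := by simp [ez]
/-- kit lemma (plumbing) [folklore] -/
theorem re_k₁ : RCLike.re (inner ℂ (convectionCoeff S c c k₁) (c k₁)) = -(Real.pi / 2) := by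
  rw [CC_k₁, c_k₁, inner_smul_left, inner_smul_right, inner_ez_ez, map_neg, Complex.conj_ofReal]
  simp; ring
/-- kit lemma (plumbing) [folklore] -/
theorem re_nk₁ : RCLike.re (inner ℂ (convectionCoeff S c c (-k₁)) (c (-k₁))) = -(Real.pi / 2) := by
  rw [CC_nk₁, c_nk₁, inner_smul_left, inner_smul_right, inner_ez_ez, map_neg, Complex.conj_ofReal]
  simp; ring
/-- kit lemma (plumbing) [folklore] -/
theorem re_k₂ : RCLike.re (inner ℂ (convectionCoeff S c c k₂) (c k₂)) = 0 := by
  rw [CC_k₂, inner_zero_left, map_zero]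
/-- kit lemma (plumbing) [folklore] -/
theorem re_nk₂ : RCLike.re (inner ℂ (convectionCoeff S c c (-k₂)) (c (-k₂))) = 0 := by
  rw [CC_nk₂, inner_zero_left, map_zero]
/-- kit lemma (plumbing) [folklore] -/
theorem re_k₃ : RCLike.re (inner ℂ (convectionCoeff S c c k₃) (c k₃)) = Real.pi / 2 := by
  rw [CC_k₃, c_k₃, inner_smul_left, inner_smul_right, inner_ez_ez]
  simp; ring
/-- kit lemma (plumbing) [folklore] -/
theorem re_nk₃ : RCLike.re (inner ℂ (convectionCoeff S c c (-k₃)) (c (-k₃))) = Real.pi / 2 := by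
  rw [CC_nk₃, c_nk₃, inner_smul_left, inner_smul_right, inner_ez_ez]
  simp; ring

/-! ### Shell weights and the transfer functional of the witness -/
/-- kit lemma (plumbing) [folklore] -/
theorem freqNormSq_k₁ : freqNormSq k₁ = 4 := by
  simp [freqNormSq, k₁, Fin.sum_univ_three]; norm_num
/-- kit lemma (plumbing) [folklore] -/
theorem freqNormSq_k₂ : freqNormSq k₂ = 2 := by
  simp [freqNormSq, k₂, Fin.sum_univ_three]; norm_num
/-- kit lemma (plumbing) [folklore] -/
theorem freqNormSq_k₃ : freqNormSq k₃ = 2 := by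
  simp [freqNormSq, k₃, Fin.sum_univ_three]; norm_num
/-- **The transfer pairing of the witness**: `⟨e^{σΔ}((v·∇)v), e^{σΔ}v⟩ = π (e^{−16π²σ} − e^{−32π²σ})`. -/
theorem pairW_convect_vW (σ : ℝ) :
    pairW σ (Torus.convect vW vW) vW =
      Real.pi * (Real.exp (-(16 * Real.pi ^ 2 * σ)) - Real.exp (-(32 * Real.pi ^ 2 * σ))) := by
  unfold pairW
  rw [tsum_eq_sum (s := S) (fun k hk => by
    rw [coeff_vW, if_neg hk, inner_zero_right, map_zero, mul_zero])]
  rw [sum_S]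
  simp only [coeff_vW, coeff_convect_vW, if_pos (show k₁ ∈ S by decide), if_pos (show -k₁ ∈ S by decide),
    if_pos (show k₂ ∈ S by decide), if_pos (show -k₂ ∈ S by decide), if_pos (show k₃ ∈ S by decide),
    if_pos (show -k₃ ∈ S by decide), re_k₁, re_nk₁, re_k₂, re_nk₂, re_k₃, re_nk₃,
    Torus.heatCoeff_apply, freqNormSq_neg, freqNormSq_k₁, freqNormSq_k₃]
  ring_nf
/-- `N_σ(v) > 0` for EVERY `σ > 0`. -/
theorem Nw_vW_pos {σ : ℝ} (hσ : 0 < σ) : 0 < Nw σ vW := by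
  unfold Nw
  rw [pairW_convect_vW]
  refine abs_pos.2 (mul_pos Real.pi_pos (sub_pos.2 (Real.exp_lt_exp.2 ?_))).ne'
  nlinarith [Real.pi_pos, sq_nonneg Real.pi, mul_pos (mul_pos Real.pi_pos Real.pi_pos) hσ]

/-! ## The refutation -/
/-- **Refutation of Theorem 1** (`Literature.Claims.NS.Faliush2026.Step_Thm1`, p. 3 l. 3–13, «∃ σ₀ > 0:
N_{σ₀}(u) ≤ ½ C_ν D̃_{σ₀}(u) for all smooth divergence-free solutions»): false as typed — the amplitude ray
`λ • vW` through the two-shell witness (each member the time-`0` slice of a classical solution on some `[0,T]`,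
`Torus.exists_classicalNS_smooth`) beats every `C` at every `σ₀ > 0` (degrees `3` vs `2`), here at `ν = 1`.
[cite: Faliush2026, Theorem 1 p.3 l.3–13] -/
theorem not_Step_Thm1 : ¬ Step_Thm1 := by
  intro h
  obtain ⟨σ₀, hσ₀, C, hC⟩ := h 1 one_pos
  refine not_exists_const_of_pos isSmooth_vW isDivFree_vW (Nw_vW_pos hσ₀) ⟨C, fun v hv hdiv => ?_⟩
  obtain ⟨T, hT, u, p, hsol, hu0, -⟩ :=
    Torus.exists_classicalNS_smooth (d := Fin 3) (by simp) one_pos.le hv hdiv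
  have h0 := hC T hT u p hsol 0 ⟨le_rfl, hT.le⟩
  rwa [hu0] at h0

end Summit.NavierStokesRegularity.NavierStokesRegularity.Theorems.Faliush2026Thm1
end
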